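import Summits.AtomisticToContinuum.HydrodynamicLimit.Theses.JaynesSqueeze
import Summits.AtomisticToContinuum.HydrodynamicLimit.Theorems.JaynesSqueezeHardSphereLDADensity
import Summits.AtomisticToContinuum.HydrodynamicLimit.Theorems.JaynesSqueezeHardSphereLDAInversion
import Summits.AtomisticToContinuum.HydrodynamicLimit.Theorems.JaynesSqueezeHardSphereLDALocalGibbs
import HarnessLib

/-!
# Hard-sphere local density approximation (route `JaynesSqueeze`, item `HardSphereLDA`) — PROVED

Support item stmt-AtomisticToContinuum-13459,
`Summit.AtomisticToContinuum.HydrodynamicLimit.Theses.JaynesSqueeze.HardSphereLDA`: under the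
low-density equation of state `HsEosLowDensity` there is a packing threshold `η₁ > 0` such that for
every reduced diameter `σ > 0`, with `g_σ(r) = f_ex(rσ³) + rσ³ f_ex′(rσ³)`:
(A) every measurable activity `Λ⁻¹ ≤ a ≤ Λ` with `Λ²σ³ ≤ η₁` is `e^c ρ e^{g_σ(ρ)}` for a measurable
unit-mass density `(2Λ²)⁻¹ ≤ ρ ≤ 2Λ²` (`activity_inversion`, file IX);
(B) for every measurable unit-mass density `c ≤ ρ₁`, `ρ₁σ³ ≤ η₁`, the activity `a₁ = ρ₁ e^{g_σ(ρ₁)}`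
and measurable velocity / positive temperature profiles: (B1) `(N+1)⁻¹ log 𝒵_N → ∫ ρ₁·ρ₁σ³f_ex′(ρ₁σ³)`
(`tendsto_freeEnergy_measurable`, file VII; the canonical partition function is the configurational
one, the tree's `BlockGibbsLine.canonicalPartition_eq_posPartition'`), (B2) the local Gibbs laws are
probability measures (the tree's `BlockGibbsLine.isProbabilityMeasure_localGibbsLaw'`), (B3) the mean
empirical density tends to `∫ χ ρ₁`
(`tendsto_meanDensity_measurable`, file VIII; the mean of a positional observable under the local Gibbs
law is its canonical Gibbs mean, `integral_empiricalDensityField_localGibbsLaw`, file X).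

The hypothesis `HsEosLowDensity` supplies the analytic free energy `F` and the canonical thermodynamic
limit; the insertion-factor package of the tree (`insertionFactor_package`:
`e^{g_σ} = Rf(·σ³)`, the activity inversion of the cluster series) identifies the limit density.
prover-pitem-stmt-AtomisticToContinuum-13459-0.
-/

noncomputable section

namespace Summit.AtomisticToContinuum.HydrodynamicLimit.Theorems

open MeasureTheory Filter Set Topology
open scoped ENNReal
open Literature.MathematicalPhysics.KineticTheory Literature.Analysis.FluidPDE
open Summit.AtomisticToContinuum.HydrodynamicLimit.Theorems.KineticWindowGronwallActivityInversion
open Summit.AtomisticToContinuum.HydrodynamicLimit.Theorems.HardSphereLDA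
open Summit.AtomisticToContinuum.HydrodynamicLimit.Theorems.BlockGibbsLine


/-! ### The theorem -/

/-- **Hard-sphere local density approximation** (route `JaynesSqueeze`, support item
`HardSphereLDA`, stmt-AtomisticToContinuum-13459): `HsEosLowDensity →` the static LDA package —
(A) activity inversion for measurable activities, and, for measurable unit-mass densities in the
dilute packing band with activity `ρ₁ e^{g_σ(ρ₁)}`, (B1) the canonical free energy per particle
converges to `∫ ρ₁ · ρ₁σ³ f_ex′(ρ₁σ³)`, (B2) the local Gibbs laws are probability measures, (B3) the
mean empirical density converges to `ρ₁`. [cite: Ruelle1969, §3.4] -/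
theorem hardSphereLDA_proof : Summit.AtomisticToContinuum.HydrodynamicLimit.Theses.JaynesSqueeze.HardSphereLDA := by
  intro hEos
  obtain ⟨η₀, hη₀, F, hFa, hEq, hF0, -, hfree⟩ := hEos
  obtain ⟨r, hr, Rf, hsol, hbd, hcont, huniq, η₂, hη₂, hη₂r, hexp⟩ := insertionFactor_package
  obtain ⟨ηA, hηA0, hA⟩ := activity_inversion hη₀ hFa hEq hF0
  obtain ⟨ηm, hηm0, hB1⟩ := tendsto_freeEnergy_measurable hη₀ hFa hEq hfree hr hsol hbd hcont huniq hη₂ hexp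
  obtain ⟨ηd, hηd0, hB3⟩ := tendsto_meanDensity_measurable hη₀ hFa hEq hfree hr hsol hbd hcont huniq hη₂ hexp
  set η₁ : ℝ := min (min ηA ηm) (min ηd (min (1 / 16) (η₂ / 2))) with hη₁
  have hη₁0 : 0 < η₁ := lt_min (lt_min hηA0 hηm0) (lt_min hηd0 (lt_min (by norm_num) (by positivity)))
  have hη₁A : η₁ ≤ ηA := (min_le_left _ _).trans (min_le_left _ _)
  have hη₁m : η₁ ≤ ηm := (min_le_left _ _).trans (min_le_right _ _)
  have hη₁d : η₁ ≤ ηd := (min_le_right _ _).trans (min_le_left _ _)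
  have hη₁16 : η₁ ≤ 1 / 16 := (min_le_right _ _).trans ((min_le_right _ _).trans (min_le_left _ _))
  have hη₁2 : η₁ ≤ η₂ / 2 := (min_le_right _ _).trans ((min_le_right _ _).trans (min_le_right _ _))
  refine ⟨η₁, hη₁0, fun σ hσ => ⟨fun Λ hΛ hpack a ham hab => ?_, fun c hc ρ₁ hρ₁m hρ₁ hρ₁1 u₁ θ₁ hu hθ hθ0 Φ => ?_⟩⟩
  · -- (A)
    exact hA σ hσ Λ hΛ (hpack.trans hη₁A) a ham hab
  · -- (B)
    have hσ3 : 0 < σ ^ 3 := pow_pos hσ 3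
    have hρlo : ∀ x, c ≤ ρ₁ x := fun x => (hρ₁ x).1
    have hpack : ∀ x, ρ₁ x * σ ^ 3 ≤ η₁ := fun x => (hρ₁ x).2
    have hρ0 : ∀ x, 0 < ρ₁ x := fun x => hc.trans_le (hρlo x)
    -- the activity `a₁ = ρ₁ e^{g(ρ₁)} = ρ₁ Rf(ρ₁σ³)`: measurable, `ρ₁ ≤ a₁ ≤ 2ρ₁ ≤ 2 η₁/σ³`
    have hmemI : ∀ x, ρ₁ x * σ ^ 3 ∈ Ioo 0 η₂ := fun x =>
      ⟨mul_pos (hρ0 x) hσ3, (hpack x).trans_lt (hη₁2.trans_lt (half_lt_self hη₂))⟩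
    have hrep : ∀ x, thermoActivity σ ρ₁ x = ρ₁ x * Rf (ρ₁ x * σ ^ 3) := fun x => by
      unfold thermoActivity; rw [hexp _ (hmemI x)]
    have hRf : ∀ x, 1 ≤ Rf (ρ₁ x * σ ^ 3) ∧ Rf (ρ₁ x * σ ^ 3) ≤ 2 := fun x =>
      hbd _ ⟨(hmemI x).1.le, ((hmemI x).2.le.trans hη₂r)⟩
    have ham₁ : Measurable (thermoActivity σ ρ₁) := by
      have h : thermoActivity σ ρ₁ = fun x => ρ₁ x * Rf (ρ₁ x * σ ^ 3) := funext hrep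
      rw [h]
      exact hρ₁m.mul (measurable_comp_of_continuousOn hcont (hρ₁m.mul_const _) fun x =>
        ⟨(hmemI x).1.le, (hmemI x).2.le.trans hη₂r⟩)
    have ha₁0 : ∀ x, 0 < thermoActivity σ ρ₁ x := fun x => by
      rw [hrep x]; exact mul_pos (hρ0 x) (by linarith [(hRf x).1])
    have ha₁A : ∀ x, thermoActivity σ ρ₁ x ≤ 2 * (η₁ / σ ^ 3) := fun x => by
      rw [hrep x]
      have h1 : ρ₁ x ≤ η₁ / σ ^ 3 := by rw [le_div_iff₀ hσ3]; exact hpack x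
      calc ρ₁ x * Rf (ρ₁ x * σ ^ 3) ≤ (η₁ / σ ^ 3) * 2 := mul_le_mul h1 (hRf x).2 (by linarith [(hRf x).1]) (by positivity)
        _ = 2 * (η₁ / σ ^ 3) := by ring
    -- `σ ≤ 1/2`
    have hρi : Integrable ρ₁ := Integrable.of_bound hρ₁m.aestronglyMeasurable (η₁ / σ ^ 3)
      (Eventually.of_forall fun x => by
        rw [Real.norm_eq_abs, abs_of_pos (hρ0 x), le_div_iff₀ hσ3]; exact hpack x)
    obtain ⟨x₁, hx₁⟩ := exists_one_le_of_integral_eq_one' hρi hρ₁1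
    have hσ2 : σ ≤ 1 / 2 := by
      have h16 : σ ^ 3 ≤ 1 / 16 := by have := hpack x₁; nlinarith
      by_contra hcn
      push Not at hcn
      have : (1 / 2 : ℝ) ^ 3 < σ ^ 3 := pow_lt_pow_left₀ hcn (by norm_num) (by norm_num)
      nlinarith
    -- the `let a₁` of the statement is `thermoActivity σ ρ₁`
    show Tendsto (fun N : ℕ => ((N : ℝ) + 1)⁻¹ * Real.log (canonicalPartition (Torus.geometry (Fin 3)) (hsDiameter σ N)
        (N + 1) (localGibbsProfile (thermoActivity σ ρ₁) u₁ θ₁))) atTop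
        (𝓝 (∫ x, ρ₁ x * (ρ₁ x * σ ^ 3 * deriv hsExcessFreeEnergy (ρ₁ x * σ ^ 3)))) ∧
      (∀ N, IsProbabilityMeasure (localGibbsLaw σ (thermoActivity σ ρ₁) u₁ θ₁ N (Φ N))) ∧
      ∀ χ : T3 → ℝ, Continuous χ → Tendsto (fun N : ℕ => ∫ z, empiricalDensityField z χ
        ∂(localGibbsLaw σ (thermoActivity σ ρ₁) u₁ θ₁ N (Φ N))) atTop (𝓝 (∫ x, χ x * ρ₁ x))
    refine ⟨?_, fun N => isProbabilityMeasure_localGibbsLaw' ham₁ hθ hu ha₁0 ha₁A hθ0 hσ2 N (Φ N), fun χ hχ => ?_⟩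
    · -- (B1)
      have h := hB1 σ hσ c hc ρ₁ hρ₁m hρlo hρ₁1 (fun x => (hpack x).trans hη₁m)
      refine h.congr fun N => ?_
      rw [canonicalPartition_eq_posPartition' ham₁ hθ hu (fun x => (ha₁0 x).le) hθ0]
      push_cast
      ring
    · -- (B3)
      have h := hB3 σ hσ c hc ρ₁ hρ₁m hρlo hρ₁1 (fun x => (hpack x).trans hη₁d) χ hχ
      refine h.congr fun N => ?_
      rw [integral_empiricalDensityField_localGibbsLaw ham₁ hθ hu (fun x => (ha₁0 x).le) hθ0 σ N (Φ N) hχ.measurable]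

end Summit.AtomisticToContinuum.HydrodynamicLimit.Theorems

end
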